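import Literature.NumberTheory.PAdicHodge.BmaxPlusFrobeniusEigenLogBdR
import Literature.NumberTheory.PAdicHodge.BmaxPlusFormalLogDivisionTower
import Literature.RingTheory.FormalGroups.PadicLogTypeSeriesDeterminant
import HarnessLib

/-!
# (K₂) for the φ-road's crystalline pair: the Legendre resolution `x̃ = Pη·b_ω − Pω·b_η` is a Teichmüller logarithm modulo `Fil^k`, up to
# `p`-powers — modulo Fontaine's kernel lemma

Topic `Literature/NumberTheory/PAdicHodge`; namespace `Literature.NumberTheory.PAdicHodge`. THEOREMS ONLY (no definition, no named fact, no
instance, no `sorry`). The B8 pre-assembly of the φ-road of line `kato_lever` (crux K★ `stmt-BirchSwinnertonDyer-22226`, memos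
`Summits/…/Cruxes/StarredOptimalManinUnitFiveSeven/Lines/kato-lever-K2-phi-road.md` §1–§2, `…-K3-legendre.md` §5/§7.3): two `A_max`-elements `Λ, Λ′`
satisfying the Dieudonné–Honda relation `φ²X − a·φX + p·X = 0` (the periods `Λ_N(ι[ũ])`, `Λ_{N′}(ι[ṽ])` of two `[p]_W`-division sequences,
`BmaxPlusFormalLogDivisionTower.frobBmaxPlus_honda_logSum_divisionLiftPt_eq_zero`) have Legendre determinant `D = Λ·φΛ′ − φΛ·Λ′ ∈ (A_max)^{φ=p}`
(`PadicLogSeries.frob_det_eq_mul_det`), and `(A_max)^{φ=p}` maps into `ℚ_p ⊗ X⁰_k` modulo `Fil^k`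
(`BmaxPlusFrobeniusEigenLogBdR.exists_isTeichLog_of_bdR_lim_modFil_of_frobBmaxPlus_eq`, modulo the Fontaine kernel `hFK` ⟸ (TDIV)). Hence:

* ★★★ `exists_isTeichLog_legendre_of_honda` — for ANY limits `b_ω, b_η, P_ω, P_η ∈ B_dR⁺` of `Λ, φΛ, Λ′, φΛ′` modulo `Fil^k` (`exists_bdR_lim_modFil`):
  **`p^n·(P_η·b_ω − P_ω·b_η) ≡ L′ (mod ξ^k B_dR⁺)` with `IsTeichLog k L′`** — the socket's (K₂) shape (`KTwoMembership`: `IsTeichLog 2 (p^N·(Pη(v)·bω − Pω(v)·bη))`)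
  for the crystalline pair `(log_W, φ∘log_W)` read through the comparison;
* ★★★ `exists_isTeichLog_legendre_divisionLiftPt` — the same for the periods of two `[p]_W`-division sequences `u` (e.g. of a rational point) and `v`
  (e.g. a torsion sequence) of an integral Weierstrass equation `W/ℤ` with `log_W` of Honda type `p − aT + T²`.

What B8 still has to decide (LEAD): how the socket consumes `P_η` (any limits of `φΛ′`, additive and `Γ_F`-equivariant only modulo `Fil^k`), and `b_ω`'s
normalisation `θ(b_ω) = p^N·log_ω(P)`; `P_ω` on torsion sequences is `p^{N′}·∫_v ω` (`BmaxPlusFormalLogTatePeriods`). Infrastructure only; BSD / K★ are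
not proved by any of this.

## References
* J.-M. Fontaine, Y. Ouyang, *Theory of p-adic Galois representations*, §6.1. [FontaineOuyang2022]
* K. Kato, *Lectures on the approach to Iwasawa theory for Hasse–Weil L-functions via B_dR*, LNM 1553 (1993), Ch. II §1.4. [Kato1993LNM1553]
* T. Honda, *On the theory of commutative formal groups*, J. Math. Soc. Japan 22 (1970), Thm. 2 (p. 223). [Honda1970]
-/

noncomputable section

open WittVector Field ValuativeRel Finset
open Literature.AlgebraicGeometry.Resolution
open Literature.RingTheory.FormalGroups

namespace Literature.NumberTheory.PAdicHodge

open Literature.NumberTheory.GaloisRepresentations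
open Literature.NumberTheory.GaloisRepresentations.IsNonarchimedeanLocalField
open Literature.NumberTheory.GaloisRepresentations.LubinTate Literature.NumberTheory.EllipticCurves
open GaloisContinuity

variable {F : Type} [Field F] [ValuativeRel F] [TopologicalSpace F] [IsNonarchimedeanLocalField F]
  [CharZero F] {p : ℕ} [Fact p.Prime] [Fact (¬ IsUnit (p : integerC F))]
  [IsAdicComplete (Ideal.span {(p : integerC F)}) (integerC F)]

set_option maxHeartbeats 3200000 in
set_option synthInstance.maxHeartbeats 400000 in
/-- ★★★ **(K₂) for a Honda pair, modulo Fontaine's kernel lemma.** Assume `hFK` (`φy = py ∧ θy = 0 ⇒ p^m y = c·t`; ⟸ (TDIV)). Let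
`Λ, Λ′ ∈ A_max = B_max⁺(F)` satisfy `φ²X − a·φX + p·X = 0` (`φ = frobBmaxPlus`; e.g. the periods of two `[p]_W`-division sequences), and let
`b_ω, b_η, P_ω, P_η ∈ B_dR⁺` be ANY limits modulo `Fil^k` of `Λ, φΛ, Λ′, φΛ′` (`exists_bdR_lim_modFil`, shifts `r₁, …, r₄`). Then there are `n ∈ ℕ` and
`L′ ∈ B_dR⁺` with **`IsTeichLog k L′` and `p^n·(P_η·b_ω − P_ω·b_η) − L′ ∈ ξ^k B_dR⁺`**: the Legendre determinant `D = Λ·φΛ′ − φΛ·Λ′` has `φD = pD`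
(`PadicLogSeries.frob_det_eq_mul_det`), its limit modulo `Fil^k` is `b_ω·P_η − b_η·P_ω` (ring structure of the comparison), and `(A_max)^{φ=p}` lands in
`ℚ_p ⊗ X⁰_k` (`exists_isTeichLog_of_bdR_lim_modFil_of_frobBmaxPlus_eq`). [cite: FontaineOuyang2022, §6.1] [cite: Kato1993LNM1553, Ch. II §1.4]
[cite: Honda1970, Thm. 2 (p. 223)] -/
theorem exists_isTeichLog_legendre_of_honda (hp : valuation F p < 1)
    (hFK : ∀ y : BmaxPlus F p, frobBmaxPlus F p y = (p : BmaxPlus F p) * y → thetaBmaxPlus F p y = 0 →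
      ∃ (k : ℕ) (c : ℤ_[p]), (p : BmaxPlus F p) ^ k * y = ainfToBmaxPlus F p (zpToAinf c) * tBmax)
    {a : BmaxPlus F p} {Λ Λ' : BmaxPlus F p}
    (hΛ : frobBmaxPlus F p (frobBmaxPlus F p Λ) - a * frobBmaxPlus F p Λ + (p : BmaxPlus F p) * Λ = 0)
    (hΛ' : frobBmaxPlus F p (frobBmaxPlus F p Λ') - a * frobBmaxPlus F p Λ' + (p : BmaxPlus F p) * Λ' = 0)
    {k : ℕ} {bω bη Pω Pη : BDeRhamPlus (integerC F) p} {r₁ r₂ r₃ r₄ : ℕ}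
    (hbω : ∀ N M : ℕ, N + r₁ ≤ M → ∀ y : bmaxZero F p,
      AdicCompletion.evalₐ (Ideal.span {(p : bmaxZero F p)}) M Λ = Ideal.Quotient.mk _ y →
      ∃ (a : Ainf (p := p) F) (w : BDeRhamPlus (integerC F) p),
        (p : BDeRhamPlus (integerC F) p) ^ k *
            (bω - algebraMap (Localization.Away (p : Ainf (p := p) F)) (BDeRhamPlus (integerC F) p)
              (y : Localization.Away (p : Ainf (p := p) F))) =
          ainfToBdR ((p : Ainf (p := p) F) ^ N * a) + xiBdR ^ k * w)
    (hbη : ∀ N M : ℕ, N + r₂ ≤ M → ∀ y : bmaxZero F p,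
      AdicCompletion.evalₐ (Ideal.span {(p : bmaxZero F p)}) M (frobBmaxPlus F p Λ) = Ideal.Quotient.mk _ y →
      ∃ (a : Ainf (p := p) F) (w : BDeRhamPlus (integerC F) p),
        (p : BDeRhamPlus (integerC F) p) ^ k *
            (bη - algebraMap (Localization.Away (p : Ainf (p := p) F)) (BDeRhamPlus (integerC F) p)
              (y : Localization.Away (p : Ainf (p := p) F))) =
          ainfToBdR ((p : Ainf (p := p) F) ^ N * a) + xiBdR ^ k * w)
    (hPω : ∀ N M : ℕ, N + r₃ ≤ M → ∀ y : bmaxZero F p,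
      AdicCompletion.evalₐ (Ideal.span {(p : bmaxZero F p)}) M Λ' = Ideal.Quotient.mk _ y →
      ∃ (a : Ainf (p := p) F) (w : BDeRhamPlus (integerC F) p),
        (p : BDeRhamPlus (integerC F) p) ^ k *
            (Pω - algebraMap (Localization.Away (p : Ainf (p := p) F)) (BDeRhamPlus (integerC F) p)
              (y : Localization.Away (p : Ainf (p := p) F))) =
          ainfToBdR ((p : Ainf (p := p) F) ^ N * a) + xiBdR ^ k * w)
    (hPη : ∀ N M : ℕ, N + r₄ ≤ M → ∀ y : bmaxZero F p,
      AdicCompletion.evalₐ (Ideal.span {(p : bmaxZero F p)}) M (frobBmaxPlus F p Λ') = Ideal.Quotient.mk _ y →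
      ∃ (a : Ainf (p := p) F) (w : BDeRhamPlus (integerC F) p),
        (p : BDeRhamPlus (integerC F) p) ^ k *
            (Pη - algebraMap (Localization.Away (p : Ainf (p := p) F)) (BDeRhamPlus (integerC F) p)
              (y : Localization.Away (p : Ainf (p := p) F))) =
          ainfToBdR ((p : Ainf (p := p) F) ^ N * a) + xiBdR ^ k * w) :
    ∃ (n : ℕ) (L' : BDeRhamPlus (integerC F) p),
      IsTeichLog k L' ∧
        (p : BDeRhamPlus (integerC F) p) ^ n * (Pη * bω - Pω * bη) - L' ∈ Ideal.span {(xiBdR : BDeRhamPlus (integerC F) p) ^ k} := by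
  -- `φD = pD` for `D = Λ·φΛ′ − φΛ·Λ′`
  have hD : frobBmaxPlus F p (Λ * frobBmaxPlus F p Λ' - frobBmaxPlus F p Λ * Λ') =
      (p : BmaxPlus F p) * (Λ * frobBmaxPlus F p Λ' - frobBmaxPlus F p Λ * Λ') :=
    PadicLogSeries.frob_det_eq_mul_det (frobBmaxPlus F p) hΛ hΛ'
  -- the limit of `D` modulo `Fil^k` is `bω·Pη − bη·Pω`
  obtain ⟨s₁, h₁⟩ := bdR_lim_modFil_mul hbω hPη
  obtain ⟨s₂, h₂⟩ := bdR_lim_modFil_mul hbη hPω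
  have hlim := bdR_lim_modFil_add h₁ (bdR_lim_modFil_neg h₂)
  rw [← sub_eq_add_neg] at hlim
  obtain ⟨n, L', hL', hmem⟩ := exists_isTeichLog_of_bdR_lim_modFil_of_frobBmaxPlus_eq hp hFK hD hlim
  refine ⟨n, L', hL', ?_⟩
  have e : Pη * bω - Pω * bη = bω * Pη + -(bη * Pω) := by ring
  rw [e]
  exact hmem

set_option maxHeartbeats 3200000 in
set_option synthInstance.maxHeartbeats 400000 in
/-- ★★★ **(K₂) for the `A_max`-periods of two division sequences, modulo Fontaine's kernel lemma.** Let `W/ℤ` be an integral Weierstrass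
equation with `log_W` of Honda type `p − aT + T²` (hypothesis `he`; `a = a_p` for good reduction, `BmaxPlusFormalLogDivisionTowerElliptic`), `u, v` two
`[p]_W`-division sequences of points of `Ŵ(𝔪_{ℂ_F})` (`u` e.g. of an `F`-rational point `P = u₀`, `v` e.g. a torsion sequence, `v₀ = 0`), with
`A_max`-periods `Λ = Λ_N(ι[ũ], z)`, `Λ′ = Λ_{N′}(ι[ṽ], z′)`, and let `b_ω, b_η, P_ω, P_η ∈ B_dR⁺` be any limits modulo `Fil^k` of `Λ, φΛ, Λ′, φΛ′`.
Then, assuming `hFK`: **`p^n·(P_η·b_ω − P_ω·b_η) ≡ L′ (mod ξ^k B_dR⁺)` with `IsTeichLog k L′`** — Kato's «`x̃ ∈ X ⊗ V`» for the φ-road's resolution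
(`P_ω ≡ p^{N′}·∫_v ω`, `BmaxPlusFormalLogTatePeriods`; `b_ω ≡ p^N·log_W(ι[ũ])`, `BmaxPlusBdRModFilPeriods`). [cite: Kato1993LNM1553, Ch. II §1.4]
[cite: FontaineOuyang2022, §6.1] [cite: Honda1970, Thm. 2 (p. 223)] -/
theorem exists_isTeichLog_legendre_divisionLiftPt (hp : valuation F p < 1)
    (hFK : ∀ y : BmaxPlus F p, frobBmaxPlus F p y = (p : BmaxPlus F p) * y → thetaBmaxPlus F p y = 0 →
      ∃ (k : ℕ) (c : ℤ_[p]), (p : BmaxPlus F p) ^ k * y = ainfToBmaxPlus F p (zpToAinf c) * tBmax)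
    {hθ : Function.Surjective (fontaineTheta (integerC F) p)} (W : WeierstrassCurve ℤ) (a : ℤ_[p]) (e : ℕ → ℤ_[p])
    (he : ∀ m : ℕ, m ≠ 0 → (m : ℤ_[p]) * e m =
      GaloisContinuity.formalLogNum W p m - (if p ∣ m then a * GaloisContinuity.formalLogNum W p (m / p) else 0) +
        (if p ^ 2 ∣ m then (p : ℤ_[p]) * GaloisContinuity.formalLogNum W p (m / p ^ 2) else 0))
    {u v : ℕ → (maxNilIdealC F).toIdeal} (hup : ∀ n, AinfTop.mulPC F p W (u (n + 1)) = u n)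
    (hvp : ∀ n, AinfTop.mulPC F p W (v (n + 1)) = v n) {N N' : ℕ} (hN : 1 ≤ N) (hN' : 1 ≤ N') {z z' : bmaxZero F p}
    (hz : algebraMap (Ainf (p := p) F) (bmaxZero F p)
        ((AinfTop.of F p).symm (((AinfTop.divisionLiftPt W hθ u hup).val : (AinfTop.nilTheta F p hθ).toIdeal) : AinfTop F p)) ^ N =
      (p : bmaxZero F p) * z)
    (hz' : algebraMap (Ainf (p := p) F) (bmaxZero F p)
        ((AinfTop.of F p).symm (((AinfTop.divisionLiftPt W hθ v hvp).val : (AinfTop.nilTheta F p hθ).toIdeal) : AinfTop F p)) ^ N' =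
      (p : bmaxZero F p) * z')
    {k : ℕ} {bω bη Pω Pη : BDeRhamPlus (integerC F) p} {r₁ r₂ r₃ r₄ : ℕ}
    (hbω : ∀ N₁ M : ℕ, N₁ + r₁ ≤ M → ∀ y : bmaxZero F p,
      AdicCompletion.evalₐ (Ideal.span {(p : bmaxZero F p)}) M
          (PadicLogSeries.logSum ((algebraMap (Ainf (p := p) F) (bmaxZero F p)).comp zpToAinf) (GaloisContinuity.formalLogNum W p) N
            (algebraMap (Ainf (p := p) F) (bmaxZero F p)
              ((AinfTop.of F p).symm (((AinfTop.divisionLiftPt W hθ u hup).val : (AinfTop.nilTheta F p hθ).toIdeal) : AinfTop F p))) z) =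
        Ideal.Quotient.mk _ y →
      ∃ (a : Ainf (p := p) F) (w : BDeRhamPlus (integerC F) p),
        (p : BDeRhamPlus (integerC F) p) ^ k *
            (bω - algebraMap (Localization.Away (p : Ainf (p := p) F)) (BDeRhamPlus (integerC F) p)
              (y : Localization.Away (p : Ainf (p := p) F))) =
          ainfToBdR ((p : Ainf (p := p) F) ^ N₁ * a) + xiBdR ^ k * w)
    (hbη : ∀ N₁ M : ℕ, N₁ + r₂ ≤ M → ∀ y : bmaxZero F p,
      AdicCompletion.evalₐ (Ideal.span {(p : bmaxZero F p)}) M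
          (frobBmaxPlus F p
            (PadicLogSeries.logSum ((algebraMap (Ainf (p := p) F) (bmaxZero F p)).comp zpToAinf) (GaloisContinuity.formalLogNum W p) N
              (algebraMap (Ainf (p := p) F) (bmaxZero F p)
                ((AinfTop.of F p).symm (((AinfTop.divisionLiftPt W hθ u hup).val : (AinfTop.nilTheta F p hθ).toIdeal) : AinfTop F p))) z)) =
        Ideal.Quotient.mk _ y →
      ∃ (a : Ainf (p := p) F) (w : BDeRhamPlus (integerC F) p),
        (p : BDeRhamPlus (integerC F) p) ^ k *
            (bη - algebraMap (Localization.Away (p : Ainf (p := p) F)) (BDeRhamPlus (integerC F) p)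
              (y : Localization.Away (p : Ainf (p := p) F))) =
          ainfToBdR ((p : Ainf (p := p) F) ^ N₁ * a) + xiBdR ^ k * w)
    (hPω : ∀ N₁ M : ℕ, N₁ + r₃ ≤ M → ∀ y : bmaxZero F p,
      AdicCompletion.evalₐ (Ideal.span {(p : bmaxZero F p)}) M
          (PadicLogSeries.logSum ((algebraMap (Ainf (p := p) F) (bmaxZero F p)).comp zpToAinf) (GaloisContinuity.formalLogNum W p) N'
            (algebraMap (Ainf (p := p) F) (bmaxZero F p)
              ((AinfTop.of F p).symm (((AinfTop.divisionLiftPt W hθ v hvp).val : (AinfTop.nilTheta F p hθ).toIdeal) : AinfTop F p))) z') =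
        Ideal.Quotient.mk _ y →
      ∃ (a : Ainf (p := p) F) (w : BDeRhamPlus (integerC F) p),
        (p : BDeRhamPlus (integerC F) p) ^ k *
            (Pω - algebraMap (Localization.Away (p : Ainf (p := p) F)) (BDeRhamPlus (integerC F) p)
              (y : Localization.Away (p : Ainf (p := p) F))) =
          ainfToBdR ((p : Ainf (p := p) F) ^ N₁ * a) + xiBdR ^ k * w)
    (hPη : ∀ N₁ M : ℕ, N₁ + r₄ ≤ M → ∀ y : bmaxZero F p,
      AdicCompletion.evalₐ (Ideal.span {(p : bmaxZero F p)}) M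
          (frobBmaxPlus F p
            (PadicLogSeries.logSum ((algebraMap (Ainf (p := p) F) (bmaxZero F p)).comp zpToAinf) (GaloisContinuity.formalLogNum W p) N'
              (algebraMap (Ainf (p := p) F) (bmaxZero F p)
                ((AinfTop.of F p).symm (((AinfTop.divisionLiftPt W hθ v hvp).val : (AinfTop.nilTheta F p hθ).toIdeal) : AinfTop F p))) z')) =
        Ideal.Quotient.mk _ y →
      ∃ (a : Ainf (p := p) F) (w : BDeRhamPlus (integerC F) p),
        (p : BDeRhamPlus (integerC F) p) ^ k *
            (Pη - algebraMap (Localization.Away (p : Ainf (p := p) F)) (BDeRhamPlus (integerC F) p)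
              (y : Localization.Away (p : Ainf (p := p) F))) =
          ainfToBdR ((p : Ainf (p := p) F) ^ N₁ * a) + xiBdR ^ k * w) :
    ∃ (n : ℕ) (L' : BDeRhamPlus (integerC F) p),
      IsTeichLog k L' ∧
        (p : BDeRhamPlus (integerC F) p) ^ n * (Pη * bω - Pω * bη) - L' ∈ Ideal.span {(xiBdR : BDeRhamPlus (integerC F) p) ^ k} := by
  have hofp : AdicCompletion.of (Ideal.span {(p : bmaxZero F p)}) (bmaxZero F p) (p : bmaxZero F p) = (p : BmaxPlus F p) :=
    map_natCast (algebraMap (bmaxZero F p) (BmaxPlus F p)) p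
  have hR := AinfTop.frobBmaxPlus_honda_logSum_divisionLiftPt_eq_zero W (hθ := hθ) a e he hup hN hz
  have hR' := AinfTop.frobBmaxPlus_honda_logSum_divisionLiftPt_eq_zero W (hθ := hθ) a e he hvp hN' hz'
  rw [hofp] at hR hR'
  exact exists_isTeichLog_legendre_of_honda hp hFK hR hR' hbω hbη hPω hPη

end Literature.NumberTheory.PAdicHodge

end
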